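import Summits.AtomisticToContinuum.HydrodynamicLimit.Theorems.TwoClocksEquilibriumFastWindowLDBirthT12ZonalT1
import Summits.AtomisticToContinuum.HydrodynamicLimit.Theorems.TwoClocksEquilibriumFastWindowLDBirthT12LogQuadraticC
import HarnessLib

/-!
# T1 in the zonal sector `ℓ = 0`, II: round 2 and the assembly `Π₀ψ₀ = q|v|² + O(C_g(1+|v|))`
# (helper `t12_zonal_T1` of the line `birth`, crux `TwoClocks.EquilibriumFastWindowLD`,
# stmt-AtomisticToContinuum-14440; §5 ASSEMBLY, sector `ℓ = 0`, of the registered analytic sub-goal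
# `t12_logLinearPreimage_and_dipoleModulus`)

Continuation of `…T12ZonalT1` (notation from there: profile `F`, `f = F ∘ ‖·‖`, Euler defect
`δ(s) = (4/s²)∫₀ˢ tF - F(s)`, zonal data `G`, `J₆ = ∫(1+|w|)⁶ dM`).

* `abs_zonalEulerDefect_le_linear` — ROUND 2 defect: once `|F(t) - q₁t²| ≤ m₂(1+t)(1+log(1+t))`, split
  `F∘‖·‖ = (F - q₁(·)²)∘‖·‖ + q₁‖·‖²` INSIDE `K₂ - lorentz` (`gainTerm_add`, `lorentzGain_add`): the lin-log piece
  costs `176π m₂(1+s)(1+log(1+s))`, while the resonant energy piece is compared EXACTLY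
  (`abs_gainTerm_normSq_sub_lorentz`, `lorentzGain_normSq`: `|K₂|·|² - π s³| ≤ (9/2)π(s+2)`, no `s²`-size error);
  hence `|δ(s)| ≤ Γ₂(1+s)` on `[1, ∞)`, `Γ₂ = 355m₂ + 15|q₁| + mJ₆/2 + C_g` — the defect `δ` of `F` and of
  `F - q₁s²` is the same function, `s²` solving the Euler equation exactly;
* `zonal_round_two` — `euler_zonal_powGrowth` (`p = 1`): `|F(s) - qs²| ≤ 5Γ₂(1+s)` on `[1, ∞)`, `|q - 4∫₀¹tF| ≤ 8Γ₂`;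
* `zonal_T1_profile` — both rounds and the small speeds `|F| ≤ 4m` on `[0, 1]`: `|q| ≤ κ(m + C_g)`,
  `|F(t) - qt²| ≤ κ(m + C_g)(1+t)` for `t ≥ 0`, `κ = 10⁹(1 + J₆)` absolute;
* the registered **`t12_zonal_T1`** — for `ψ` continuous with `|ψ| ≤ A(1+|v|²)(1+log(1+|v|²))`, `ψ ⊥_M` the
  collision invariants, `Lψ = g` pointwise, `|g| ≤ C_g(1+|v|²)` (the conclusions of
  `t12_logQuadraticPreimage_of_quadraticData`, `A = C·C_g`): `|Π₀ψ(v) - q|v|²| ≤ c(A + C_g)(1+|v|)`,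
  `|q| ≤ c(A + C_g)`, `c` absolute — along a ray the profile `F(t) = Π₀ψ(te)` meets `zonal_T1_profile`
  (`sectorEquation_zonalAvg`, Z4 `zonalAvg_orthogonal_collisionInvariants`, `abs_zonalAvg_le_radial`);
* `zonal_T1_quadraticData` — the same packaged with `t12_logQuadraticPreimage_of_quadraticData`: for admissible
  quadratic data the orthogonal pre-image has `Π₀ψ₀ = q|v|² + O(cC_g(1+|v|))`, `|q| ≤ cC_g`, uniformly in `R`.

After the shift `-q(|v|² - 3)` the zonal part of the corrector is `3q + O(C_g(1+|v|))`: T1 in the sector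
`ℓ = 0`. [folklore] (Grad 1963 §4; Cercignani–Illner–Pulvirenti 1994 §7.2; plan §5 of the line `birth`.)
-/

noncomputable section

open MeasureTheory ProbabilityTheory Real Set Filter Metric
open scoped ENNReal BigOperators InnerProductSpace

namespace Summit.AtomisticToContinuum.HydrodynamicLimit.Theorems.ClampedCorrectorBirth

open Literature.Analysis.FluidPDE Literature.MathematicalPhysics.KineticTheory
open Literature.Analysis.UnboundedOperators

variable {F : ℝ → ℝ} {m : ℝ}

/-! ### Round 2: peeling off the resonant monopole `q₁ s²` exactly, the defect becomes linear -/

/-- **Round-2 defect bound.** If moreover `|F(t) - q₁t²| ≤ m₂(1+t)(1+log(1+t))` for `t ≥ 0`, then at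
`s ≥ 1`: `|(4/s²)∫₀ˢ tF - F(s)| ≤ Γ₂ (1+s)`, `Γ₂ = 355 m₂ + 15|q₁| + m J₆/2 + C_g` — split
`F∘‖·‖ = (F - q₁(·)²)∘‖·‖ + q₁‖·‖²` inside `K₂ - lorentz` (`gainTerm_add`, `lorentzGain_add`): the lin-log
piece costs `176π m₂ (1+s)(1+log(1+s))` (`abs_gainTerm_radial_sub_lorentzGain_le_logLinear`), the ENERGY
piece only `(9/2)π|q₁|(s+2)` (`abs_gainTerm_normSq_sub_lorentz`, `lorentzGain_normSq`: no `s²`-size error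
for the resonant power); (e-ν): `(ν - πs)|F| ≤ (3π/2)(|q₁|s + m₂(1+s)(1+log(1+s)))`. [folklore] -/
theorem abs_zonalEulerDefect_le_linear (hFm : Measurable F)
    (hFW : ∀ t, |F t| ≤ m * (1 + t ^ 2) * (1 + Real.log (1 + t ^ 2)))
    (horth : ∀ φ ∈ collisionInvariants (EuclideanSpace ℝ (Fin 3)),
      maxwellianInner (fun x : EuclideanSpace ℝ (Fin 3) => F ‖x‖) φ = 0)
    {q₁ m₂ : ℝ} (hF₁ : ∀ t, 0 ≤ t → |F t - q₁ * t ^ 2| ≤ m₂ * ((1 + t) * (1 + Real.log (1 + t))))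
    (e : sphere (0 : EuclideanSpace ℝ (Fin 3)) 1) {Cg s G : ℝ} (hCg : 0 ≤ Cg) (hs : 1 ≤ s)
    (hG : |G| ≤ Cg * (1 + s ^ 2))
    (hS : collisionFrequency (s • (e : EuclideanSpace ℝ (Fin 3))) * F s =
      gainTerm (fun x : EuclideanSpace ℝ (Fin 3) => F ‖x‖) (s • (e : EuclideanSpace ℝ (Fin 3))) -
        lossTerm (fun x : EuclideanSpace ℝ (Fin 3) => F ‖x‖) (s • (e : EuclideanSpace ℝ (Fin 3))) - G) :
    |4 / s ^ 2 * (∫ t in (0:ℝ)..s, t * F t) - F s| ≤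
      (355 * m₂ + 15 * |q₁| + m * (∫ w, (1 + ‖w‖) ^ 6 ∂stdGaussian (EuclideanSpace ℝ (Fin 3))) / 2 + Cg) *
        (1 + s) := by
  obtain ⟨J, hJ0, hJ⟩ : ∃ J : ℝ, 0 ≤ J ∧ (∫ w, (1 + ‖w‖) ^ 6 ∂stdGaussian (EuclideanSpace ℝ (Fin 3))) = J :=
    ⟨_, integral_nonneg fun w => by positivity, rfl⟩
  rw [hJ]
  obtain ⟨hm, h4, h32, -⟩ := zonalProfile_apriori hFW
  have hm₂ : 0 ≤ m₂ := by have h := hF₁ 0 le_rfl; norm_num at h; exact (abs_nonneg _).trans h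
  have hs0 : 0 < s := by linarith
  obtain ⟨hdef, hν0, hν1⟩ := abs_zonalEulerDefect_le hFm e hs0 hS
  set v : EuclideanSpace ℝ (Fin 3) := s • (e : EuclideanSpace ℝ (Fin 3)) with hv
  have hvn : ‖v‖ = s := by rw [hv, norm_smul_sphere, abs_of_pos hs0]
  have hv0 : v ≠ 0 := by rw [← norm_ne_zero_iff, hvn]; exact hs0.ne'
  obtain ⟨hw1, hw0⟩ := one_add_le_linLog hs0.le
  -- the split `F ∘ ‖·‖ = G₁ ∘ ‖·‖ + q₁ ‖·‖²`
  have hG₁m : Measurable (fun t => F t - q₁ * t ^ 2) := hFm.sub (measurable_const.mul (measurable_id.pow_const 2))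
  have hu₁m : Measurable (fun x : EuclideanSpace ℝ (Fin 3) => F ‖x‖ - q₁ * ‖x‖ ^ 2) := hG₁m.comp measurable_norm
  have hu₂m : Measurable (fun x : EuclideanSpace ℝ (Fin 3) => q₁ * ‖x‖ ^ 2) := by fun_prop
  have hC₁ : ∀ x : EuclideanSpace ℝ (Fin 3), |F ‖x‖ - q₁ * ‖x‖ ^ 2| ≤ (32 * m + 2 * |q₁|) * Real.exp (‖x‖ ^ 2 / 4) :=
    fun x => by
      have h1 := h32 x
      have h2 := abs_norm_sq_le_two_mul_exp x
      rw [abs_of_nonneg (sq_nonneg _)] at h2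
      calc |F ‖x‖ - q₁ * ‖x‖ ^ 2| ≤ |F ‖x‖| + |q₁ * ‖x‖ ^ 2| := abs_sub _ _
        _ ≤ 32 * m * Real.exp (‖x‖ ^ 2 / 4) + |q₁| * (2 * Real.exp (‖x‖ ^ 2 / 4)) := by
            rw [abs_mul, abs_of_nonneg (sq_nonneg ‖x‖)]
            exact add_le_add h1 (mul_le_mul_of_nonneg_left h2 (abs_nonneg _))
        _ = (32 * m + 2 * |q₁|) * Real.exp (‖x‖ ^ 2 / 4) := by ring
  have hC₂ : ∀ x : EuclideanSpace ℝ (Fin 3), |q₁ * ‖x‖ ^ 2| ≤ 2 * |q₁| * Real.exp (‖x‖ ^ 2 / 4) := fun x => by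
    have h2 := abs_norm_sq_le_two_mul_exp x
    rw [abs_of_nonneg (sq_nonneg _)] at h2
    rw [abs_mul, abs_of_nonneg (sq_nonneg ‖x‖)]
    calc |q₁| * ‖x‖ ^ 2 ≤ |q₁| * (2 * Real.exp (‖x‖ ^ 2 / 4)) := mul_le_mul_of_nonneg_left h2 (abs_nonneg _)
      _ = 2 * |q₁| * Real.exp (‖x‖ ^ 2 / 4) := by ring
  have hb₁ : ∀ R : ℝ, ∃ C : ℝ, ∀ x : EuclideanSpace ℝ (Fin 3), ‖x‖ ≤ R → |F ‖x‖ - q₁ * ‖x‖ ^ 2| ≤ C :=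
    fun R => ⟨m₂ * (1 + |R|) ^ 2, fun x hx => by
      have h := hF₁ ‖x‖ (norm_nonneg x)
      have hl := Real.log_le_sub_one_of_pos (by positivity : (0:ℝ) < 1 + ‖x‖)
      have hR : ‖x‖ ≤ |R| := hx.trans (le_abs_self R)
      have h1 : (1 + ‖x‖) * (1 + Real.log (1 + ‖x‖)) ≤ (1 + |R|) ^ 2 := by
        calc (1 + ‖x‖) * (1 + Real.log (1 + ‖x‖)) ≤ (1 + ‖x‖) * (1 + ‖x‖) :=
              mul_le_mul_of_nonneg_left (by linarith) (by positivity)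
          _ ≤ (1 + |R|) * (1 + |R|) := mul_le_mul (by linarith) (by linarith) (by positivity) (by positivity)
          _ = (1 + |R|) ^ 2 := by ring
      exact h.trans (mul_le_mul_of_nonneg_left h1 hm₂)⟩
  have hb₂ : ∀ R : ℝ, ∃ C : ℝ, ∀ x : EuclideanSpace ℝ (Fin 3), ‖x‖ ≤ R → |q₁ * ‖x‖ ^ 2| ≤ C :=
    fun R => ⟨|q₁| * R ^ 2, fun x hx => by
      rw [abs_mul, abs_of_nonneg (sq_nonneg ‖x‖)]
      exact mul_le_mul_of_nonneg_left (pow_le_pow_left₀ (norm_nonneg _) hx 2) (abs_nonneg _)⟩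
  have hsplit : (fun x : EuclideanSpace ℝ (Fin 3) => F ‖x‖) =
      fun x => (F ‖x‖ - q₁ * ‖x‖ ^ 2) + q₁ * ‖x‖ ^ 2 := by
    funext x; ring
  have hgain : gainTerm (fun x : EuclideanSpace ℝ (Fin 3) => F ‖x‖) v =
      gainTerm (fun x : EuclideanSpace ℝ (Fin 3) => F ‖x‖ - q₁ * ‖x‖ ^ 2) v +
        q₁ * gainTerm (fun x : EuclideanSpace ℝ (Fin 3) => ‖x‖ ^ 2) v := by
    rw [hsplit, gainTerm_add hu₁m hu₂m hC₁ hC₂ v, gainTerm_const_mul q₁ (fun x : EuclideanSpace ℝ (Fin 3) => ‖x‖ ^ 2) v]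
  have hlor : lorentzGain (fun x : EuclideanSpace ℝ (Fin 3) => F ‖x‖) v =
      lorentzGain (fun x : EuclideanSpace ℝ (Fin 3) => F ‖x‖ - q₁ * ‖x‖ ^ 2) v + q₁ * (π * s ^ 3) := by
    rw [hsplit, lorentzGain_add v hu₁m hb₁ hu₂m hb₂,
      lorentzGain_const_mul q₁ (u := fun x : EuclideanSpace ℝ (Fin 3) => ‖x‖ ^ 2) v, lorentzGain_normSq, hvn]
  have hA₁ : |gainTerm (fun x : EuclideanSpace ℝ (Fin 3) => F ‖x‖ - q₁ * ‖x‖ ^ 2) v -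
      lorentzGain (fun x : EuclideanSpace ℝ (Fin 3) => F ‖x‖ - q₁ * ‖x‖ ^ 2) v| ≤
      176 * π * (m₂ * ((1 + s) * (1 + Real.log (1 + s)))) := by
    have h := abs_gainTerm_radial_sub_lorentzGain_le_logLinear (G := fun t => F t - q₁ * t ^ 2) hG₁m
      (fun t ht => (hF₁ t ht).trans_eq (by ring)) v
    rw [hvn] at h
    exact h.trans_eq (by ring)
  have hA₂ : |gainTerm (fun x : EuclideanSpace ℝ (Fin 3) => ‖x‖ ^ 2) v - π * s ^ 3| ≤ 9 / 2 * π * (s + 2) := by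
    have h := abs_gainTerm_normSq_sub_lorentz v
    rwa [hvn] at h
  have hA : |gainTerm (fun x : EuclideanSpace ℝ (Fin 3) => F ‖x‖) v -
      lorentzGain (fun x : EuclideanSpace ℝ (Fin 3) => F ‖x‖) v| ≤
      176 * π * (m₂ * ((1 + s) * (1 + Real.log (1 + s)))) + |q₁| * (9 / 2 * π * (s + 2)) := by
    have e1 : gainTerm (fun x : EuclideanSpace ℝ (Fin 3) => F ‖x‖) v -
        lorentzGain (fun x : EuclideanSpace ℝ (Fin 3) => F ‖x‖) v =
        (gainTerm (fun x : EuclideanSpace ℝ (Fin 3) => F ‖x‖ - q₁ * ‖x‖ ^ 2) v -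
          lorentzGain (fun x : EuclideanSpace ℝ (Fin 3) => F ‖x‖ - q₁ * ‖x‖ ^ 2) v) +
        q₁ * (gainTerm (fun x : EuclideanSpace ℝ (Fin 3) => ‖x‖ ^ 2) v - π * s ^ 3) := by
      rw [hgain, hlor]; ring
    rw [e1]
    refine (abs_add_le _ _).trans (add_le_add hA₁ ?_)
    rw [abs_mul]
    exact mul_le_mul_of_nonneg_left hA₂ (abs_nonneg _)
  have hB : |lossTerm (fun x : EuclideanSpace ℝ (Fin 3) => F ‖x‖) v| ≤ π * m * J / 2 := by
    have h := abs_lossTerm_le_of_quartic (u := fun x : EuclideanSpace ℝ (Fin 3) => F ‖x‖)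
      (hFm.comp measurable_norm) h4 horth hv0
    rw [hvn, hJ] at h
    have h2 : π / (2 * s) ≤ π / 2 := div_le_div_of_nonneg_left pi_pos.le two_pos (by linarith)
    calc _ ≤ π / (2 * s) * (m * J) := h
      _ ≤ π / 2 * (m * J) := mul_le_mul_of_nonneg_right h2 (mul_nonneg hm hJ0)
      _ = π * m * J / 2 := by ring
  have hD : (collisionFrequency v - π * s) * |F s| ≤
      3 * π / 2 * (|q₁| * s) + 3 * π / 2 * (m₂ * ((1 + s) * (1 + Real.log (1 + s)))) := by
    have hν2 : collisionFrequency v - π * s ≤ 3 * π / 2 := (le_mul_of_one_le_right hν0 hs).trans hν1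
    have hFs : |F s| ≤ m₂ * ((1 + s) * (1 + Real.log (1 + s))) + |q₁| * s ^ 2 := by
      have h := hF₁ s hs0.le
      have h2 : |F s| ≤ |F s - q₁ * s ^ 2| + |q₁ * s ^ 2| := by
        have := abs_add_le (F s - q₁ * s ^ 2) (q₁ * s ^ 2)
        rwa [sub_add_cancel] at this
      rw [abs_mul, abs_of_nonneg (sq_nonneg s)] at h2
      linarith only [h, h2]
    have k1 := mul_le_mul_of_nonneg_left hFs hν0
    have k2 := mul_le_mul_of_nonneg_right hν1 (by positivity : (0:ℝ) ≤ |q₁| * s)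
    have k3 := mul_le_mul_of_nonneg_right hν2 (mul_nonneg hm₂ (zero_le_one.trans hw0))
    linarith only [k1, k2, k3]
  -- bookkeeping: everything is `≤ const · π s (1+s)`
  have hπ1 : (1:ℝ) ≤ π := by linarith only [Real.pi_gt_three]
  have hs1 : s + 2 ≤ 3 * (s * (1 + s)) := by nlinarith only [hs]
  have hs2 : (1:ℝ) ≤ s * (1 + s) := by nlinarith only [hs]
  have hs3 : 1 + s ^ 2 ≤ s * (1 + s) := by nlinarith only [hs]
  have r1 : m₂ * ((1 + s) * (1 + Real.log (1 + s))) ≤ m₂ * (2 * s * (1 + s)) :=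
    mul_le_mul_of_nonneg_left (linLog_le_mul_linear hs) hm₂
  have r2 : |q₁| * (s + 2) ≤ |q₁| * (3 * (s * (1 + s))) := mul_le_mul_of_nonneg_left hs1 (abs_nonneg _)
  have r3 : π * m * J / 2 * 1 ≤ π * m * J / 2 * (s * (1 + s)) :=
    mul_le_mul_of_nonneg_left hs2 (by positivity)
  have r4 : Cg * (1 + s ^ 2) ≤ Cg * (s * (1 + s)) := mul_le_mul_of_nonneg_left hs3 hCg
  have r4' : 1 * (Cg * (s * (1 + s))) ≤ π * (Cg * (s * (1 + s))) := mul_le_mul_of_nonneg_right hπ1 (by positivity)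
  have r5 : |q₁| * s * 1 ≤ |q₁| * s * (1 + s) := mul_le_mul_of_nonneg_left (by linarith only [hs]) (by positivity)
  have u1 := mul_le_mul_of_nonneg_left r1 (by positivity : (0:ℝ) ≤ π)
  have u2 := mul_le_mul_of_nonneg_left r2 (by positivity : (0:ℝ) ≤ π)
  have u5 := mul_le_mul_of_nonneg_left r5 (by positivity : (0:ℝ) ≤ π)
  have hsum : |gainTerm (fun x : EuclideanSpace ℝ (Fin 3) => F ‖x‖) v -
      lorentzGain (fun x : EuclideanSpace ℝ (Fin 3) => F ‖x‖) v| +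
      |lossTerm (fun x : EuclideanSpace ℝ (Fin 3) => F ‖x‖) v| + |G| + (collisionFrequency v - π * s) * |F s| ≤
      π * s * ((355 * m₂ + 15 * |q₁| + m * J / 2 + Cg) * (1 + s)) := by
    linarith only [hA, hB, hG, hD, u1, u2, r3, r4, r4', u5]
  have hπs : 0 < π * s := by positivity
  have h := hdef.trans hsum
  rw [abs_mul, abs_of_pos hπs] at h
  exact le_of_mul_le_mul_left h hπs

/-- **Round 2 of the `ℓ = 0` bootstrap.** Under the hypotheses of `abs_zonalEulerDefect_le_linear` at every
`s ≥ 1` and continuity of `F`, the power Euler lemma `euler_zonal_powGrowth` (`p = 1`, `a = 0`, `s₀ = 1`)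
yields the quadratic coefficient `q` with `|q - 4∫₀¹ tF| ≤ 8Γ₂` and the LINEAR remainder
`|F(s) - q s²| ≤ 5Γ₂(1+s)` for `s ≥ 1`. [folklore] -/
theorem zonal_round_two (hFc : Continuous F)
    (hFW : ∀ t, |F t| ≤ m * (1 + t ^ 2) * (1 + Real.log (1 + t ^ 2)))
    (horth : ∀ φ ∈ collisionInvariants (EuclideanSpace ℝ (Fin 3)),
      maxwellianInner (fun x : EuclideanSpace ℝ (Fin 3) => F ‖x‖) φ = 0)
    {q₁ m₂ : ℝ} (hF₁ : ∀ t, 0 ≤ t → |F t - q₁ * t ^ 2| ≤ m₂ * ((1 + t) * (1 + Real.log (1 + t))))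
    (e : sphere (0 : EuclideanSpace ℝ (Fin 3)) 1) {Cg : ℝ} {G : ℝ → ℝ} (hCg : 0 ≤ Cg)
    (hG : ∀ s, 1 ≤ s → |G s| ≤ Cg * (1 + s ^ 2))
    (hS : ∀ s, 1 ≤ s → collisionFrequency (s • (e : EuclideanSpace ℝ (Fin 3))) * F s =
      gainTerm (fun x : EuclideanSpace ℝ (Fin 3) => F ‖x‖) (s • (e : EuclideanSpace ℝ (Fin 3))) -
        lossTerm (fun x : EuclideanSpace ℝ (Fin 3) => F ‖x‖) (s • (e : EuclideanSpace ℝ (Fin 3))) - G s) :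
    ∃ q : ℝ, |q - 4 * ∫ t in (0:ℝ)..1, t * F t| ≤
        8 * (355 * m₂ + 15 * |q₁| + m * (∫ w, (1 + ‖w‖) ^ 6 ∂stdGaussian (EuclideanSpace ℝ (Fin 3))) / 2 + Cg) ∧
      ∀ s, 1 ≤ s → |F s - q * s ^ 2| ≤
        5 * (355 * m₂ + 15 * |q₁| + m * (∫ w, (1 + ‖w‖) ^ 6 ∂stdGaussian (EuclideanSpace ℝ (Fin 3))) / 2 + Cg) *
          (1 + s) := by
  have hδ : ∀ s, 1 ≤ s → |4 / s ^ 2 * (∫ t in (0:ℝ)..s, t * F t) - F s| ≤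
      (355 * m₂ + 15 * |q₁| + m * (∫ w, (1 + ‖w‖) ^ 6 ∂stdGaussian (EuclideanSpace ℝ (Fin 3))) / 2 + Cg) *
        (1 + s) ^ (1:ℝ) := fun s hs => by
    rw [Real.rpow_one]
    exact abs_zonalEulerDefect_le_linear hFc.measurable hFW horth hF₁ e hCg hs (hG s hs) (hS s hs)
  have hE : ∀ s, (1:ℝ) ≤ s → F s = 4 / s ^ 2 * (∫ t in (0:ℝ)..s, t * F t) -
      (0 * s + (4 / s ^ 2 * (∫ t in (0:ℝ)..s, t * F t) - F s)) := fun s _ => by ring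
  obtain ⟨q, hq, hrem⟩ := euler_zonal_powGrowth (p := 1) (a := 0) one_pos zero_le_one one_lt_two
    hFc.continuousOn ((continuous_id.mul hFc).intervalIntegrable 0 1) hδ hE
  refine ⟨q, ?_, fun s hs => ?_⟩
  · have h := hq
    norm_num [Real.rpow_one] at h
    convert h using 1
    ring
  · have h := hrem s hs
    rw [Real.rpow_one] at h
    norm_num at h
    convert h using 2

/-! ### T1 in the zonal sector -/

/-- **T1 (`ℓ = 0`) in profile form, with constants linear in `m + C_g`.** For a continuous profile `F`
of the quadratic-log class (`|F| ≤ m(1+t²)(1+log(1+t²))`) with `F ∘ ‖·‖ ⊥_M` the collision invariants,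
zonal data `|G(s)| ≤ C_g(1+s²)` and the zonal sector equation along a ray `s ↦ s e` (`s ≥ 1`), there is
`q` with `|q| ≤ κ(m + C_g)` and `|F(t) - q t²| ≤ κ(m + C_g)(1+t)` for all `t ≥ 0`; `κ = 10⁹(1 + J₆)` is
absolute (rounds 1 and 2, then `|F| ≤ 4m` on `[0,1]`). [folklore] -/
theorem zonal_T1_profile : ∃ κ : ℝ, 0 < κ ∧ ∀ (F G : ℝ → ℝ)
    (e : sphere (0 : EuclideanSpace ℝ (Fin 3)) 1) (m Cg : ℝ), Continuous F →
    (∀ t, |F t| ≤ m * (1 + t ^ 2) * (1 + Real.log (1 + t ^ 2))) →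
    (∀ φ ∈ collisionInvariants (EuclideanSpace ℝ (Fin 3)),
      maxwellianInner (fun x : EuclideanSpace ℝ (Fin 3) => F ‖x‖) φ = 0) →
    0 ≤ Cg → (∀ s, 1 ≤ s → |G s| ≤ Cg * (1 + s ^ 2)) →
    (∀ s, 1 ≤ s → collisionFrequency (s • (e : EuclideanSpace ℝ (Fin 3))) * F s =
      gainTerm (fun x : EuclideanSpace ℝ (Fin 3) => F ‖x‖) (s • (e : EuclideanSpace ℝ (Fin 3))) -
        lossTerm (fun x : EuclideanSpace ℝ (Fin 3) => F ‖x‖) (s • (e : EuclideanSpace ℝ (Fin 3))) - G s) →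
    ∃ q : ℝ, |q| ≤ κ * (m + Cg) ∧ ∀ t, 0 ≤ t → |F t - q * t ^ 2| ≤ κ * (m + Cg) * (1 + t) := by
  obtain ⟨J, hJ0, hJ⟩ : ∃ J : ℝ, 0 ≤ J ∧ (∫ w, (1 + ‖w‖) ^ 6 ∂stdGaussian (EuclideanSpace ℝ (Fin 3))) = J :=
    ⟨_, integral_nonneg fun w => by positivity, rfl⟩
  refine ⟨10 ^ 9 * (1 + J), by positivity, fun F G e m Cg hFc hFW horth hCg hG hS => ?_⟩
  obtain ⟨hm, -, -, h4m⟩ := zonalProfile_apriori hFW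
  obtain ⟨q₁, hq₁, hF₁⟩ := t12_zonal_round1 F G e m Cg hFc hFW horth hCg hG hS
  rw [hJ] at hq₁ hF₁
  obtain ⟨q, hq, hrem⟩ := zonal_round_two hFc hFW horth hF₁ e hCg hG hS
  rw [hJ] at hq hrem
  have hI := abs_firstMoment_one_le_of_quadLog hFW
  have hU0 : 0 ≤ (1 + J) * (m + Cg) := by positivity
  have hmU : m ≤ (1 + J) * (m + Cg) := by nlinarith only [hm, hCg, hJ0]
  have hCU : Cg ≤ (1 + J) * (m + Cg) := by nlinarith only [hm, hCg, hJ0]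
  have hmJ : m * J ≤ (1 + J) * (m + Cg) := by nlinarith only [hm, hCg, hJ0]
  have hΓ₁ : (5638 + J) * m + Cg ≤ 5638 * ((1 + J) * (m + Cg)) := by nlinarith only [hm, hCg, hJ0]
  have hq₁U : |q₁| ≤ 180432 * ((1 + J) * (m + Cg)) := by linarith only [hq₁, hΓ₁, hmU]
  have hm₂U : 9 * ((5638 + J) * m + Cg) + 4 * m + |q₁| ≤ 231178 * ((1 + J) * (m + Cg)) := by
    linarith only [hΓ₁, hmU, hq₁U]
  have hΓ₂U : 355 * (9 * ((5638 + J) * m + Cg) + 4 * m + |q₁|) + 15 * |q₁| + m * J / 2 + Cg ≤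
      84774672 * ((1 + J) * (m + Cg)) := by linarith only [hm₂U, hq₁U, hmJ, hCU, hU0]
  have hqU : |q| ≤ 678197392 * ((1 + J) * (m + Cg)) := by
    have h1 : |q| ≤ |q - 4 * ∫ t in (0:ℝ)..1, t * F t| + |4 * ∫ t in (0:ℝ)..1, t * F t| := by
      have := abs_add_le (q - 4 * ∫ t in (0:ℝ)..1, t * F t) (4 * ∫ t in (0:ℝ)..1, t * F t)
      rwa [sub_add_cancel] at this
    rw [abs_mul, show |(4:ℝ)| = 4 by norm_num] at h1
    linarith only [h1, hq, hI, hΓ₂U, hmU]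
  refine ⟨q, by linarith only [hqU, hU0], fun t ht => ?_⟩
  have hUt : 0 ≤ (1 + J) * (m + Cg) * (1 + t) := by positivity
  rcases le_or_gt 1 t with ht1 | ht1
  · have h := hrem t ht1
    have h2 := mul_le_mul_of_nonneg_right hΓ₂U (by positivity : (0:ℝ) ≤ 1 + t)
    linarith only [h, h2, hUt]
  · have h1 : |F t - q * t ^ 2| ≤ 4 * m + |q| := by
      have ht2 : t ^ 2 ≤ 1 := by nlinarith only [ht, ht1]
      calc |F t - q * t ^ 2| ≤ |F t| + |q * t ^ 2| := abs_sub _ _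
        _ ≤ 4 * m + |q| * 1 := by
            rw [abs_mul, abs_of_nonneg (sq_nonneg t)]
            exact add_le_add (h4m t ht ht1.le) (mul_le_mul_of_nonneg_left ht2 (abs_nonneg _))
        _ = 4 * m + |q| := by ring
    have hUt' : (1 + J) * (m + Cg) * 1 ≤ (1 + J) * (m + Cg) * (1 + t) :=
      mul_le_mul_of_nonneg_left (by linarith only [ht]) hU0
    linarith only [h1, hmU, hqU, hUt', hU0]

/-- **Registered helper `t12_zonal_T1` — T1 in the zonal sector for a log-quadratic solution of `Lψ = g`.** There is an absolute `c > 0` such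
that for every continuous `ψ` on `ℝ³` with `|ψ(v)| ≤ A(1+|v|²)(1+log(1+|v|²))`, `ψ ⊥_M` the collision
invariants and `Lψ = g` pointwise with `|g(v)| ≤ C_g(1+|v|²)` — the conclusions of
`t12_logQuadraticPreimage_of_quadraticData` for the orthogonal pre-image of admissible quadratic data, with
`A = C·C_g` — the zonal average is quadratic plus LINEAR: `|Π₀ψ(v) - q|v|²| ≤ c(A + C_g)(1+|v|)` with
`|q| ≤ c(A + C_g)`. After the shift by the energy invariant `-q(|v|² - 3)` the `ℓ = 0` part of the corrector is
`3q + O((A + C_g)(1+|v|))`: item T1 of `t12_logLinearPreimage_and_dipoleModulus` in the sector `ℓ = 0`. [folklore] -/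
theorem t12_zonal_T1 : ∃ c : ℝ, 0 < c ∧ ∀ (ψ g : EuclideanSpace ℝ (Fin 3) → ℝ) (A Cg : ℝ), Continuous ψ → (∀ v, |ψ v| ≤ A * (1 + ‖v‖ ^ 2) * (1 + Real.log (1 + ‖v‖ ^ 2))) → (∀ φ ∈ Literature.Analysis.UnboundedOperators.collisionInvariants (EuclideanSpace ℝ (Fin 3)), Literature.Analysis.UnboundedOperators.maxwellianInner ψ φ = 0) → (∀ v, Literature.Analysis.UnboundedOperators.hardSphereLinearizedOp ψ v = g v) → (∀ v, |g v| ≤ Cg * (1 + ‖v‖ ^ 2)) → ∃ q : ℝ, |q| ≤ c * (A + Cg) ∧ ∀ v : EuclideanSpace ℝ (Fin 3), |(4 * Real.pi)⁻¹ * (∫ ω : Metric.sphere (0 : EuclideanSpace ℝ (Fin 3)) 1, ψ (‖v‖ • (ω : EuclideanSpace ℝ (Fin 3))) ∂Literature.MathematicalPhysics.KineticTheory.sphereMeasure) - q * ‖v‖ ^ 2| ≤ c * (A + Cg) * (1 + ‖v‖) := by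
  obtain ⟨κ, hκ, hprof⟩ := zonal_T1_profile
  refine ⟨κ, hκ, fun ψ g A Cg hψc hψA horth hL hg => ?_⟩
  have hA0 : 0 ≤ A := by have h := hψA 0; norm_num at h; exact (abs_nonneg _).trans h
  have hCg : 0 ≤ Cg := by have h := hg 0; norm_num at h; exact (abs_nonneg _).trans h
  have hψm : Measurable ψ := hψc.measurable
  have hψG : ∀ x, |ψ x| ≤ 32 * A * Real.exp (‖x‖ ^ 2 / 4) := fun x => by
    calc |ψ x| ≤ A * (1 + ‖x‖ ^ 2) * (1 + Real.log (1 + ‖x‖ ^ 2)) := hψA x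
      _ = A * ((1 + ‖x‖ ^ 2) * (1 + Real.log (1 + ‖x‖ ^ 2))) := by ring
      _ ≤ A * (32 * Real.exp (‖x‖ ^ 2 / 4)) :=
          mul_le_mul_of_nonneg_left (quadLog_le_pow_four_and_exp ‖x‖).2 hA0
      _ = 32 * A * Real.exp (‖x‖ ^ 2 / 4) := by ring
  obtain ⟨e⟩ : Nonempty (sphere (0 : EuclideanSpace ℝ (Fin 3)) 1) :=
    (NormedSpace.sphere_nonempty.2 zero_le_one).to_subtype
  obtain ⟨F, hF⟩ : ∃ F : ℝ → ℝ, F = fun t => zonalAvg ψ (t • (e : EuclideanSpace ℝ (Fin 3))) := ⟨_, rfl⟩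
  have hfF : zonalAvg ψ = fun x => F ‖x‖ := by
    funext x
    rw [hF]
    exact zonalAvg_eq_of_norm_eq ψ (by rw [norm_smul_sphere, abs_norm])
  have hFc : Continuous F := by
    rw [hF]
    exact (continuous_zonalAvg hψc).comp (continuous_id.smul continuous_const)
  have hFW : ∀ t, |F t| ≤ A * (1 + t ^ 2) * (1 + Real.log (1 + t ^ 2)) := fun t => by
    have h := abs_zonalAvg_le_radial (W := fun r => A * (1 + r ^ 2) * (1 + Real.log (1 + r ^ 2))) hψA
      (t • (e : EuclideanSpace ℝ (Fin 3)))
    rw [norm_smul_sphere, sq_abs] at h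
    rw [hF]
    exact h
  have horthF : ∀ φ ∈ collisionInvariants (EuclideanSpace ℝ (Fin 3)),
      maxwellianInner (fun x : EuclideanSpace ℝ (Fin 3) => F ‖x‖) φ = 0 := by
    rw [← hfF]
    exact zonalAvg_orthogonal_collisionInvariants hψm hψG horth
  have hG : ∀ s, 1 ≤ s → |zonalAvg g (s • (e : EuclideanSpace ℝ (Fin 3)))| ≤ Cg * (1 + s ^ 2) := fun s _ => by
    have h := abs_zonalAvg_le_radial (ψ := g) (W := fun r => Cg * (1 + r ^ 2)) hg (s • (e : EuclideanSpace ℝ (Fin 3)))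
    rwa [norm_smul_sphere, sq_abs] at h
  have hLg : hardSphereLinearizedOp ψ = g := funext hL
  have hS : ∀ s, 1 ≤ s → collisionFrequency (s • (e : EuclideanSpace ℝ (Fin 3))) * F s =
      gainTerm (fun x : EuclideanSpace ℝ (Fin 3) => F ‖x‖) (s • (e : EuclideanSpace ℝ (Fin 3))) -
        lossTerm (fun x : EuclideanSpace ℝ (Fin 3) => F ‖x‖) (s • (e : EuclideanSpace ℝ (Fin 3))) -
        zonalAvg g (s • (e : EuclideanSpace ℝ (Fin 3))) := fun s hs => by
    have h := sectorEquation_zonalAvg hψm hψG (s • (e : EuclideanSpace ℝ (Fin 3)))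
    rw [hLg, hfF] at h
    have hn : ‖s • (e : EuclideanSpace ℝ (Fin 3))‖ = s := by rw [norm_smul_sphere, abs_of_pos (by linarith)]
    simpa only [hn] using h
  obtain ⟨q, hq, hrem⟩ := hprof F (fun s => zonalAvg g (s • (e : EuclideanSpace ℝ (Fin 3)))) e A Cg
    hFc hFW horthF hCg hG hS
  refine ⟨q, hq, fun v => ?_⟩
  have h := hrem ‖v‖ (norm_nonneg v)
  have e1 : zonalAvg ψ v = F ‖v‖ := by rw [hfF]
  change |zonalAvg ψ v - q * ‖v‖ ^ 2| ≤ _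
  rwa [e1]

/-- **T1 in the zonal sector for the orthogonal pre-image of admissible quadratic data** (packaged with
`t12_logQuadraticPreimage_of_quadraticData`): there is an absolute `c > 0` such that for every continuous
`g` with `|g| ≤ C_g(1+|v|²)`, supported in a ball and `M`-orthogonal to the collision invariants, the
`M`-orthogonal pre-image `ψ₀` (`Lψ₀ = g`, continuous, `L²(M)`, `|ψ₀| ≤ c C_g(1+|v|²)(1+log(1+|v|²))`)
has zonal part `Π₀ψ₀ = q|v|² + O(c C_g (1+|v|))` with `|q| ≤ c C_g`, uniformly in the support radius. [folklore] -/
theorem zonal_T1_quadraticData : ∃ c : ℝ, 0 < c ∧ ∀ (g : EuclideanSpace ℝ (Fin 3) → ℝ) (Cg R : ℝ),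
    Continuous g → (∀ v, |g v| ≤ Cg * (1 + ‖v‖ ^ 2)) → (∀ v, R ≤ ‖v‖ → g v = 0) →
    (∀ φ ∈ collisionInvariants (EuclideanSpace ℝ (Fin 3)), maxwellianInner g φ = 0) →
    ∃ ψ₀ : EuclideanSpace ℝ (Fin 3) → ℝ, Continuous ψ₀ ∧
      MemLp ψ₀ 2 (stdGaussian (EuclideanSpace ℝ (Fin 3))) ∧
      (∀ φ ∈ collisionInvariants (EuclideanSpace ℝ (Fin 3)), maxwellianInner ψ₀ φ = 0) ∧
      (∀ v, hardSphereLinearizedOp ψ₀ v = g v) ∧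
      (∀ v, |ψ₀ v| ≤ c * Cg * (1 + ‖v‖ ^ 2) * (1 + Real.log (1 + ‖v‖ ^ 2))) ∧
      ∃ q : ℝ, |q| ≤ c * Cg ∧ ∀ v, |zonalAvg ψ₀ v - q * ‖v‖ ^ 2| ≤ c * Cg * (1 + ‖v‖) := by
  obtain ⟨C, hC, hpre⟩ := t12_logQuadraticPreimage_of_quadraticData
  obtain ⟨κ, hκ, hT1⟩ := t12_zonal_T1
  refine ⟨(κ + 1) * (C + 1), by positivity, fun g Cg R hg hgb hsupp horth => ?_⟩
  obtain ⟨ψ₀, hc, hb, hmem, horth₀, hL⟩ := hpre g Cg R hg hgb hsupp horth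
  obtain ⟨q, hq, hrem⟩ := hT1 ψ₀ g (C * Cg) Cg hc hb horth₀ hL hgb
  have hCg : 0 ≤ Cg := by have h := hgb 0; norm_num at h; exact (abs_nonneg _).trans h
  have hk : κ * (C * Cg + Cg) ≤ (κ + 1) * (C + 1) * Cg := by nlinarith only [hκ, hC, hCg]
  refine ⟨ψ₀, hc, hmem, horth₀, hL, fun v => (hb v).trans ?_, q, hq.trans hk, fun v => (hrem v).trans ?_⟩
  · have hW : 0 ≤ (1 + ‖v‖ ^ 2) * (1 + Real.log (1 + ‖v‖ ^ 2)) :=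
      mul_nonneg (by positivity) (by linarith only [Real.log_nonneg (by nlinarith only [sq_nonneg ‖v‖] : (1:ℝ) ≤ 1 + ‖v‖ ^ 2)])
    have hc1 : C * Cg ≤ (κ + 1) * (C + 1) * Cg := by
      linarith only [mul_nonneg (mul_nonneg hκ.le hC.le) hCg, mul_nonneg hκ.le hCg, hCg]
    calc C * Cg * (1 + ‖v‖ ^ 2) * (1 + Real.log (1 + ‖v‖ ^ 2))
        = C * Cg * ((1 + ‖v‖ ^ 2) * (1 + Real.log (1 + ‖v‖ ^ 2))) := by ring
      _ ≤ (κ + 1) * (C + 1) * Cg * ((1 + ‖v‖ ^ 2) * (1 + Real.log (1 + ‖v‖ ^ 2))) :=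
          mul_le_mul_of_nonneg_right hc1 hW
      _ = _ := by ring
  · exact mul_le_mul_of_nonneg_right hk (by positivity)

end Summit.AtomisticToContinuum.HydrodynamicLimit.Theorems.ClampedCorrectorBirth

end
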